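import Mathlib
import HarnessLib
import Summits.FinalStateConjecture.FinalStateConjecture.Theses.ZeroEnergyKerrOrBomb
import Literature.Geometry.Lorentzian.Stationary
import Literature.Geometry.Lorentzian.KerrData

/-!
# Sketch — crux-ideate stmt-FinalStateConjecture-10690 (ZeroEnergyRigidity), ideator 2, round 1

First lemmas of the two idea cards of this seat (they need not be proved; they must elaborate):

* `KerrStuffingRigidity` (card `osculating-frontier-induction`, First lemma = first fruit of the lever):
  a smooth Ricci-flat metric on the horizon-penetrating Kerr–Schild chart `Kerr.region a r₀`
  (`r₋ < r₀ < r₊`, `|a| < M`) for which `∂_{t*}` is Killing and which COINCIDES with the Kerr metric off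
  the `∂_{t*}`-orbit of a compact subset of the exterior `{r > r₊}` is globally isometric to Kerr by a
  diffeomorphism which is the identity off the orbit of a (possibly larger) compact set.  No smallness,
  no non-trapping hypothesis: the frontier induction uses only `R′(r) < 0` for zero-energy rays
  (`kerr_zeroEnergy_radialPotential_deriv_neg`, PROVED below — the same inequality as the route's
  support item `KerrNoZeroEnergyTrapping`) and the Alexakis–Ionescu–Klainerman local extension of Killing
  fields across `T`-conditionally pseudo-convex hypersurfaces.
* `kerr_zeroEnergy_radialPotential_deriv_neg` (card `osculating-frontier-induction`, the 1-D convexity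
  core, kernel-checked): for `E = 0` the Carter radial potential `R(r) = a²L² − Δ(r)(L² + Q)`,
  `Δ = r² − 2Mr + a²`, has `R′(r) = −2(r − M)(L² + Q) < 0` for `r > M`, `Q ≥ 0`, `(L, Q) ≠ 0`; hence every
  tangency of a zero-energy ray with a level set `{r = c}` is a strict radial MAXIMUM (`r̈ = R′/(2Σ²) < 0`):
  the level sets of `r` are strictly `T`-conditionally pseudo-convex for outward continuation on the whole
  Kerr exterior.
* `HorizonKillingNormGradient` (card `dock-hawking-step-shared-crux`, First lemma): for the Killing field
  `K` handed out by h3 (`IsNonDegenerateHorizon`: `K` Killing, `K ≠ 0` and flow-tangent on `𝓔⁺`,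
  `∇_K K = κ K`, `κ ≠ 0`), the squared norm `Φ = g(K, K)` vanishes on the horizon and its differential there
  is `dΦ(X) = −2κ g(K, X)` — non-zero, so `Φ` is a defining function of `𝓔⁺` near `𝓔⁺` and `K` is
  non-null on a punctured neighbourhood; with the causal sign lemma (the d.o.c. lies on the past side of
  `𝓔⁺`, `κ > 0` for the future-directed generator) `K` is TIMELIKE on the outer collar — the
  `Killing–timelike collar` hypothesis of the shared Hawking-step cruxes
  `AnalyticityInvadesErgoregion.NonTrappingHawkingRigidity` (stmt-13896) /
  `BeltLiouville.SmoothHawkingRigidity` (stmt-10441).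
-/

namespace Summit.FinalStateConjecture.FinalStateConjecture.Cruxes.ZeroEnergyRigidity.SketchIdeator2

open scoped BigOperators Topology Manifold Classical ContDiff
open Filter Set Function

/-- Card `osculating-frontier-induction`, 1-D convexity core (PROVED): the zero-energy Carter radial
potential is strictly decreasing beyond `r = M`. -/
theorem kerr_zeroEnergy_radialPotential_deriv_neg (M a L Q r : ℝ) (hr : M < r) (hQ : 0 ≤ Q)
    (hLQ : L ≠ 0 ∨ Q ≠ 0) :
    deriv (fun s : ℝ ↦ a ^ 2 * L ^ 2 - (s ^ 2 - 2 * M * s + a ^ 2) * (L ^ 2 + Q)) r < 0 := by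
  have hd : deriv (fun s : ℝ ↦ a ^ 2 * L ^ 2 - (s ^ 2 - 2 * M * s + a ^ 2) * (L ^ 2 + Q)) r
      = -((2 * r - 2 * M) * (L ^ 2 + Q)) := by
    have h1 : HasDerivAt (fun s : ℝ ↦ a ^ 2 * L ^ 2 - (s ^ 2 - 2 * M * s + a ^ 2) * (L ^ 2 + Q))
        (0 - ((2 * r ^ (2 - 1) * 1 - 2 * M * 1 + 0) * (L ^ 2 + Q))) r := by
      apply HasDerivAt.sub (hasDerivAt_const _ _)
      apply HasDerivAt.mul_const
      apply HasDerivAt.add (HasDerivAt.sub ?_ ?_) (hasDerivAt_const _ _)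
      · simpa using (hasDerivAt_pow 2 r)
      · simpa using (hasDerivAt_id r).const_mul (2 * M)
    rw [h1.deriv]; ring
  rw [hd]
  have hpos : 0 < L ^ 2 + Q := by
    rcases hLQ with hL | hQ'
    · have : 0 < L ^ 2 := by positivity
      linarith
    · have : 0 < Q := lt_of_le_of_ne hQ (Ne.symm hQ')
      have : 0 ≤ L ^ 2 := sq_nonneg L
      linarith
  have : 0 < (2 * r - 2 * M) * (L ^ 2 + Q) := by
    apply mul_pos _ hpos; linarith
  linarith

/-- Card `osculating-frontier-induction`, First lemma (first fruit of the lever, provable with in-print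
tools): KERR STUFFING RIGIDITY — a smooth stationary (`∂_{t*}` Killing) Ricci-flat metric on the
horizon-penetrating Kerr–Schild chart which equals Kerr off the stationary orbit of a compact subset of the
exterior is Kerr up to a diffeomorphism supported in the orbit of a compact set. -/
def KerrStuffingRigidity : Prop :=
  open Literature.Geometry.Lorentzian in
  ∀ [Kerr.Facts] (M a r₀ : ℝ), Kerr.IsSubextremal M a → Kerr.rMinus M a < r₀ → r₀ < Kerr.rPlus M a →
    ∀ (g' : LorentzianMetric 𝓘(ℝ, E4) ∞ (Kerr.region a r₀)) [g'.HasLeviCivita],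
      g'.toPseudoRiemannianMetric.IsRicciFlat →
      g'.toPseudoRiemannianMetric.IsKillingField (Kerr.stationaryField a r₀) →
      (∃ S : Set (Kerr.region a r₀), IsCompact S ∧
        (∀ x ∈ S, Kerr.rPlus M a < Kerr.radius a x.1) ∧
        ∀ x : Kerr.region a r₀, x ∉ stationaryOrbit (Kerr.stationaryField a r₀) S →
          g'.val x = (Kerr.smoothMetric M a r₀).val x) →
      ∃ Ψ : Kerr.region a r₀ → Kerr.region a r₀, Function.Bijective Ψ ∧
        PseudoRiemannianMetric.IsIsometricImmersion
          (Kerr.smoothMetric M a r₀).toPseudoRiemannianMetric g'.toPseudoRiemannianMetric Ψ ∧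
        ∃ S' : Set (Kerr.region a r₀), IsCompact S' ∧
          (∀ x ∈ S', Kerr.rPlus M a < Kerr.radius a x.1) ∧
          ∀ x : Kerr.region a r₀, x ∉ stationaryOrbit (Kerr.stationaryField a r₀) S' → Ψ x = x

/-- Card `dock-hawking-step-shared-crux`, First lemma: the horizon Killing field of h3 has squared norm
vanishing on `𝓔⁺` with differential `dΦ(X) = −2κ g(K, X)` there (so `Φ` defines `𝓔⁺` and `K` is non-null
on a punctured neighbourhood; timelike on the outer collar once the causal sign `κ > 0` is in). -/
def HorizonKillingNormGradient : Prop :=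
  open Literature.Geometry.Lorentzian in
  ∀ (𝓑 : StationaryAFBlackHole.{0}) [𝓑.metric.HasLeviCivita]
    (K : Π x : 𝓑.carrier, TangentSpace (𝓡 4) x) (κ : ℝ),
    𝓑.metric.toPseudoRiemannianMetric.IsKillingField K →
    (∀ p ∈ 𝓑.horizon, 𝓑.metric.leviCivita K p (K p) = κ • K p) →
    ∀ p ∈ 𝓑.horizon,
      𝓑.metric.val p (K p) (K p) = 0 ∧
      ∀ X : TangentSpace (𝓡 4) p,
        mfderiv (𝓡 4) 𝓘(ℝ, ℝ) (fun x ↦ 𝓑.metric.val x (K x) (K x)) p X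
          = -2 * κ * 𝓑.metric.val p (K p) X

/-- Card `dock-hawking-step-shared-crux`, the collar statement the docking needs (AIE/BeltLiouville
hypothesis `∀ x ∈ U ∩ doc, g(K,K) < 0`), in this crux's telescope: h1–h4 ⇒ a Killing–timelike collar. -/
def TelescopeCollar : Prop :=
  open Literature.Geometry.Lorentzian in
  ∀ (𝓑 : StationaryAFBlackHole.{0}) [𝓑.metric.HasLeviCivita],
    𝓑.metric.toPseudoRiemannianMetric.IsRicciFlat → IsConnected 𝓑.horizon →
    𝓑.toSpacetime.IsNonDegenerateHorizon 𝓑.Mext →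
    𝓑.metric.IsGloballyHyperbolic 𝓑.timeOrientation →
    ∃ (U : Set 𝓑.carrier) (K : Π x : 𝓑.carrier, TangentSpace (𝓡 4) x),
      IsOpen U ∧ 𝓑.horizon ⊆ U ∧ 𝓑.metric.toPseudoRiemannianMetric.IsKillingField K ∧
      (∀ p ∈ 𝓑.horizon, K p ≠ 0) ∧
      (∀ γ : ℝ → 𝓑.carrier, IsMIntegralCurve γ K → γ 0 ∈ 𝓑.horizon → ∀ t, γ t ∈ 𝓑.horizon) ∧
      ∀ x ∈ U ∩ 𝓑.doc, 𝓑.metric.val x (K x) (K x) < 0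

end Summit.FinalStateConjecture.FinalStateConjecture.Cruxes.ZeroEnergyRigidity.SketchIdeator2
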